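import Mathlib
import HarnessLib
import Summits.ResolutionOfSingularities.ResolutionOfSingularities.Theorems.WildQuotientsWildQuotientResolutionJordanFourI6StableJ4
import Summits.ResolutionOfSingularities.ResolutionOfSingularities.Theorems.WildQuotientsWildQuotientResolutionJordanFourOrder
import Summits.ResolutionOfSingularities.ResolutionOfSingularities.Theorems.WildQuotientsWildQuotientResolutionToricExitChartStable
import Summits.ResolutionOfSingularities.ResolutionOfSingularities.Theorems.WildQuotientsWildQuotientResolutionToricExitJordanThreeBrickNonempty
import Literature.AlgebraicGeometry.Resolution.BlowupPrincipalCharts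
import Literature.AlgebraicGeometry.Resolution.BlowupsEquivariant

/-!
# V4U piece 0: the principal chart `V[x_a²]` of `Bl_{I₆} 𝔸ⁿ` is `⟨σ⟩`-stable, affine and non-empty
(crux stmt-ResolutionOfSingularities-15640 `WildQuotients.WildQuotientResolution`, line `Sketch`;
chain w45c programme V4U, `L/w45c/V4U-DESIGN.md` §2/§5 (piece `O₀ = V₀ = D₊(x_a²t)`), RULING v6.3
(3) «stub-5 = the bridge-brick seat for V4U»; written by res-D-pv-033 AS res-L1-w45c-stub-5;
[OURS · L1 W4.5c] — NOT a statement of any manuscript.)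

`J₄` datum (`σ x_b = x_b + x_a`, `σ x_c = x_c + x_b`, `σ x_d = x_d + x_c`, passengers fixed),
`I₆` = the generator vector of record, `V = Bl_{I₆} 𝔸ⁿ`, lifted action
`(affineBlowup.isBlowup _).liftAction ρ (JordanFour.idealSheaf_I6_comap …)`, and the Literature
principal chart `V[⊤, x_a²] = blowupChart π Ĩ₆ ⊤ x_a²` (the `μ₃` root chart of the design):

* `JordanFour.smul_X_a`, `JordanFour.smul_X_a_sq` — every `g ∈ ⟨σ⟩` fixes `x_a` and `x_a²`
  (`⟨σ⟩` has finite order, `JordanFour.pow_prime_eq_one`, and `JordanFour.pow_apply_X_of_ne`);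
* `JordanFour.preimage_blowupChart_I6_a_eq` — `V[⊤, x_a²]` is stable under the lifted action
  (stub-2's `ToricExit.preimage_blowupChart_eq_self_of_action`, p488231);
* `JordanFour.isAffineOpen_blowupChart_I6_a`, `JordanFour.blowupChart_I6_a_nonempty` — it is
  affine (`IsBlowup.isAffineOpen_blowupChart`) and non-empty (`BlowupExit.affineBlowup_blowupChart_nonempty`,
  p498242).
These are the scheme-level inputs making `V[⊤, x_a²]` itself the stable affine piece `O₀` of the
three-piece exit (`BlowupExit.hasResolution_glued_of_three_pieces`, p492084).
-/

-- single-problem summit: the doubled namespace component `ResolutionOfSingularities` is forced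
set_option linter.dupNamespace false

noncomputable section

open CategoryTheory AlgebraicGeometry TopologicalSpace MvPolynomial HomogeneousLocalization
open Literature.AlgebraicGeometry.Resolution

namespace Summit.ResolutionOfSingularities.ResolutionOfSingularities.Theorems.WildQuotientResolution.JordanFour

/-- **Every element of `⟨σ⟩` fixes `x_a`** (`J₄` datum, `char k = p ≥ 5`). [folklore] -/
theorem smul_X_a (p : ℕ) (hp : p.Prime) (hp5 : 5 ≤ p) (k : Type) [Field k] [CharP k p] (n : ℕ)
    (σ : MvPolynomial (Fin n) k ≃ₐ[k] MvPolynomial (Fin n) k) (a b c d : Fin n)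
    (hab : a ≠ b) (hac : a ≠ c) (had : a ≠ d)
    (hb : σ (X b) = X b + X a) (hc : σ (X c) = X c + X b) (hd : σ (X d) = X d + X c)
    (hσ : ∀ i, i ≠ b → i ≠ c → i ≠ d → σ (X i) = X i) (g : ↥(Subgroup.zpowers σ)) :
    g • (X a : MvPolynomial (Fin n) k) = X a := by
  have hfin : IsOfFinOrder σ := isOfFinOrder_iff_pow_eq_one.mpr
    ⟨p, hp.pos, pow_prime_eq_one k n σ a b c d hab hac had hb hc hd hσ p hp hp5⟩
  obtain ⟨m, hm⟩ : (g : MvPolynomial (Fin n) k ≃ₐ[k] MvPolynomial (Fin n) k) ∈ Submonoid.powers σ :=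
    hfin.mem_powers_iff_mem_zpowers.mpr g.2
  change (g : MvPolynomial (Fin n) k ≃ₐ[k] MvPolynomial (Fin n) k) (X a) = X a
  rw [← hm]
  exact pow_apply_X_of_ne k n σ b c d hσ m a hab hac had

/-- **Every element of `⟨σ⟩` fixes `x_a²`.** [folklore] -/
theorem smul_X_a_sq (p : ℕ) (hp : p.Prime) (hp5 : 5 ≤ p) (k : Type) [Field k] [CharP k p] (n : ℕ)
    (σ : MvPolynomial (Fin n) k ≃ₐ[k] MvPolynomial (Fin n) k) (a b c d : Fin n)
    (hab : a ≠ b) (hac : a ≠ c) (had : a ≠ d)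
    (hb : σ (X b) = X b + X a) (hc : σ (X c) = X c + X b) (hd : σ (X d) = X d + X c)
    (hσ : ∀ i, i ≠ b → i ≠ c → i ≠ d → σ (X i) = X i) (g : ↥(Subgroup.zpowers σ)) :
    g • (X a ^ 2 : MvPolynomial (Fin n) k) = X a ^ 2 := by
  have h := smul_X_a p hp hp5 k n σ a b c d hab hac had hb hc hd hσ g
  change (g : MvPolynomial (Fin n) k ≃ₐ[k] MvPolynomial (Fin n) k) (X a) = X a at h
  change (g : MvPolynomial (Fin n) k ≃ₐ[k] MvPolynomial (Fin n) k) (X a ^ 2) = X a ^ 2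
  rw [map_pow, h]

/-- **Brick: `V[⊤, x_a²]` is `⟨σ⟩`-stable** under the lifted action on `V = Bl_{I₆} 𝔸ⁿ`
(`σ x_a² = x_a²`; stub-2's `ToricExit.preimage_blowupChart_eq_self_of_action`, p488231).
[OURS · L1 W4.5c] [folklore; assembly of landed decls] -/
theorem preimage_blowupChart_I6_a_eq (p : ℕ) (hp : p.Prime) (hp5 : 5 ≤ p)
    (k : Type) [Field k] [CharP k p] (n : ℕ)
    (σ : MvPolynomial (Fin n) k ≃ₐ[k] MvPolynomial (Fin n) k) (a b c d : Fin n)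
    (hab : a ≠ b) (hac : a ≠ c) (had : a ≠ d)
    (hb : σ (X b) = X b + X a) (hc : σ (X c) = X c + X b) (hd : σ (X d) = X d + X c)
    (hσ : ∀ i, i ≠ b → i ≠ c → i ≠ d → σ (X i) = X i)
    (ρ : ↥(Subgroup.zpowers σ) →* Aut (Spec (CommRingCat.of (MvPolynomial (Fin n) k))))
    (hρ : ∀ g : ↥(Subgroup.zpowers σ), (ρ g).hom = Spec.map (CommRingCat.ofHom
      ((MulSemiringAction.toRingEquiv (↥(Subgroup.zpowers σ)) (MvPolynomial (Fin n) k) g⁻¹ :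
        MvPolynomial (Fin n) k ≃+* MvPolynomial (Fin n) k) :
          MvPolynomial (Fin n) k →+* MvPolynomial (Fin n) k)))
    (g : ↥(Subgroup.zpowers σ)) :
    (((affineBlowup.isBlowup (Ideal.span (Set.range
        (![X a ^ 2, X a * X b ^ 2, X a * X b * X c, X a * X c ^ 3, X b ^ 3, X b ^ 2 * X c ^ 2,
          X b * X c ^ 4, X c ^ 6] : Fin 8 → MvPolynomial (Fin n) k)))).liftAction ρ
        (idealSheaf_I6_comap k n σ a b c (hσ a hab hac had) hb hc ρ hρ)) g).hom ⁻¹ᵁ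
      blowupChart
        (affineBlowup.π (Ideal.span (Set.range
          (![X a ^ 2, X a * X b ^ 2, X a * X b * X c, X a * X c ^ 3, X b ^ 3, X b ^ 2 * X c ^ 2,
            X b * X c ^ 4, X c ^ 6] : Fin 8 → MvPolynomial (Fin n) k))))
        (affineBlowup.idealSheaf (Ideal.span (Set.range
          (![X a ^ 2, X a * X b ^ 2, X a * X b * X c, X a * X c ^ 3, X b ^ 3, X b ^ 2 * X c ^ 2,
            X b * X c ^ 4, X c ^ 6] : Fin 8 → MvPolynomial (Fin n) k))))
        ⟨⊤, isAffineOpen_top _⟩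
        ((Scheme.ΓSpecIso (CommRingCat.of (MvPolynomial (Fin n) k))).inv.hom (X a ^ 2)) =
      blowupChart
        (affineBlowup.π (Ideal.span (Set.range
          (![X a ^ 2, X a * X b ^ 2, X a * X b * X c, X a * X c ^ 3, X b ^ 3, X b ^ 2 * X c ^ 2,
            X b * X c ^ 4, X c ^ 6] : Fin 8 → MvPolynomial (Fin n) k))))
        (affineBlowup.idealSheaf (Ideal.span (Set.range
          (![X a ^ 2, X a * X b ^ 2, X a * X b * X c, X a * X c ^ 3, X b ^ 3, X b ^ 2 * X c ^ 2,
            X b * X c ^ 4, X c ^ 6] : Fin 8 → MvPolynomial (Fin n) k))))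
        ⟨⊤, isAffineOpen_top _⟩
        ((Scheme.ΓSpecIso (CommRingCat.of (MvPolynomial (Fin n) k))).inv.hom (X a ^ 2)) := by
  have hIdeal : (affineBlowup.idealSheaf (Ideal.span (Set.range
      (![X a ^ 2, X a * X b ^ 2, X a * X b * X c, X a * X c ^ 3, X b ^ 3, X b ^ 2 * X c ^ 2,
        X b * X c ^ 4, X c ^ 6] : Fin 8 → MvPolynomial (Fin n) k)))).ideal ⟨⊤, isAffineOpen_top _⟩ =
      (Ideal.span (Set.range
        (![X a ^ 2, X a * X b ^ 2, X a * X b * X c, X a * X c ^ 3, X b ^ 3, X b ^ 2 * X c ^ 2,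
          X b * X c ^ 4, X c ^ 6] : Fin 8 → MvPolynomial (Fin n) k))).map
        (Scheme.ΓSpecIso (CommRingCat.of (MvPolynomial (Fin n) k))).inv.hom := by
    change (Scheme.IdealSheafData.ofIdealTop _).ideal ⟨⊤, isAffineOpen_top _⟩ = _
    rw [ideal_ofIdealTop_top]
  have hxa : (Scheme.ΓSpecIso (CommRingCat.of (MvPolynomial (Fin n) k))).inv.hom (X a ^ 2) ∈
      (affineBlowup.idealSheaf (Ideal.span (Set.range
        (![X a ^ 2, X a * X b ^ 2, X a * X b * X c, X a * X c ^ 3, X b ^ 3, X b ^ 2 * X c ^ 2,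
          X b * X c ^ 4, X c ^ 6] : Fin 8 → MvPolynomial (Fin n) k)))).ideal
        ⟨⊤, isAffineOpen_top _⟩ := by
    rw [hIdeal]
    exact Ideal.mem_map_of_mem _ (Ideal.subset_span ⟨0, rfl⟩)
  exact ToricExit.preimage_blowupChart_eq_self_of_action (affineBlowup.isBlowup _) ρ _
    (fun g => (affineBlowup.isBlowup _).liftAction_hom_comp ρ _ g)
    (idealSheaf_I6_comap k n σ a b c (hσ a hab hac had) hb hc ρ hρ) hxa
    (fun g => ToricExit.specAction_appTop_ΓSpecIso_inv ρ hρ (X a ^ 2)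
      (smul_X_a_sq p hp hp5 k n σ a b c d hab hac had hb hc hd hσ) g) g

/-- **`V[⊤, x_a²]` is an affine open of `Bl_{I₆} 𝔸ⁿ`.** [cite: StacksProject, Tag 0804] -/
theorem isAffineOpen_blowupChart_I6_a (k : Type) [Field k] (n : ℕ) (a b c : Fin n) :
    IsAffineOpen (blowupChart
      (affineBlowup.π (Ideal.span (Set.range
        (![X a ^ 2, X a * X b ^ 2, X a * X b * X c, X a * X c ^ 3, X b ^ 3, X b ^ 2 * X c ^ 2,
          X b * X c ^ 4, X c ^ 6] : Fin 8 → MvPolynomial (Fin n) k))))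
      (affineBlowup.idealSheaf (Ideal.span (Set.range
        (![X a ^ 2, X a * X b ^ 2, X a * X b * X c, X a * X c ^ 3, X b ^ 3, X b ^ 2 * X c ^ 2,
          X b * X c ^ 4, X c ^ 6] : Fin 8 → MvPolynomial (Fin n) k))))
      ⟨⊤, isAffineOpen_top _⟩
      ((Scheme.ΓSpecIso (CommRingCat.of (MvPolynomial (Fin n) k))).inv.hom (X a ^ 2))) := by
  have hIdeal : (affineBlowup.idealSheaf (Ideal.span (Set.range
      (![X a ^ 2, X a * X b ^ 2, X a * X b * X c, X a * X c ^ 3, X b ^ 3, X b ^ 2 * X c ^ 2,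
        X b * X c ^ 4, X c ^ 6] : Fin 8 → MvPolynomial (Fin n) k)))).ideal ⟨⊤, isAffineOpen_top _⟩ =
      (Ideal.span (Set.range
        (![X a ^ 2, X a * X b ^ 2, X a * X b * X c, X a * X c ^ 3, X b ^ 3, X b ^ 2 * X c ^ 2,
          X b * X c ^ 4, X c ^ 6] : Fin 8 → MvPolynomial (Fin n) k))).map
        (Scheme.ΓSpecIso (CommRingCat.of (MvPolynomial (Fin n) k))).inv.hom := by
    change (Scheme.IdealSheafData.ofIdealTop _).ideal ⟨⊤, isAffineOpen_top _⟩ = _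
    rw [ideal_ofIdealTop_top]
  refine (affineBlowup.isBlowup _).isAffineOpen_blowupChart ?_
  rw [hIdeal]
  exact Ideal.mem_map_of_mem _ (Ideal.subset_span ⟨0, rfl⟩)

/-- **`V[⊤, x_a²] ≠ ∅`** (`x_a² ≠ 0` in the domain `k[x]`, so the Rees chart ring at `x_a²` is
non-trivial, and `D₊(x_a² t) ⊆ V[⊤, x_a²]`). [folklore] -/
theorem blowupChart_I6_a_nonempty (k : Type) [Field k] (n : ℕ) (a b c : Fin n) :
    ((blowupChart
      (affineBlowup.π (Ideal.span (Set.range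
        (![X a ^ 2, X a * X b ^ 2, X a * X b * X c, X a * X c ^ 3, X b ^ 3, X b ^ 2 * X c ^ 2,
          X b * X c ^ 4, X c ^ 6] : Fin 8 → MvPolynomial (Fin n) k))))
      (affineBlowup.idealSheaf (Ideal.span (Set.range
        (![X a ^ 2, X a * X b ^ 2, X a * X b * X c, X a * X c ^ 3, X b ^ 3, X b ^ 2 * X c ^ 2,
          X b * X c ^ 4, X c ^ 6] : Fin 8 → MvPolynomial (Fin n) k))))
      ⟨⊤, isAffineOpen_top _⟩
      ((Scheme.ΓSpecIso (CommRingCat.of (MvPolynomial (Fin n) k))).inv.hom (X a ^ 2)) :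
        (affineBlowup (Ideal.span (Set.range
          (![X a ^ 2, X a * X b ^ 2, X a * X b * X c, X a * X c ^ 3, X b ^ 3, X b ^ 2 * X c ^ 2,
            X b * X c ^ 4, X c ^ 6] : Fin 8 → MvPolynomial (Fin n) k)))).Opens) :
      Set (affineBlowup (Ideal.span (Set.range
        (![X a ^ 2, X a * X b ^ 2, X a * X b * X c, X a * X c ^ 3, X b ^ 3, X b ^ 2 * X c ^ 2,
          X b * X c ^ 4, X c ^ 6] : Fin 8 → MvPolynomial (Fin n) k))))).Nonempty := by
  have hxa : (X a ^ 2 : MvPolynomial (Fin n) k) ∈ Ideal.span (Set.range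
      (![X a ^ 2, X a * X b ^ 2, X a * X b * X c, X a * X c ^ 3, X b ^ 3, X b ^ 2 * X c ^ 2,
        X b * X c ^ 4, X c ^ 6] : Fin 8 → MvPolynomial (Fin n) k)) :=
    Ideal.subset_span ⟨0, rfl⟩
  haveI := BlowupExit.nontrivial_away_reesT_of_ne_zero (X a ^ 2 : MvPolynomial (Fin n) k) hxa
    (pow_ne_zero 2 (X_ne_zero a))
  exact BlowupExit.affineBlowup_blowupChart_nonempty (X a ^ 2 : MvPolynomial (Fin n) k) hxa

end Summit.ResolutionOfSingularities.ResolutionOfSingularities.Theorems.WildQuotientResolution.JordanFour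

end
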